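import Summits.QuantumFields.YangMills.Theses.PencilRigidity
import Summits.QuantumFields.YangMills.Theorems.CurvatureBoostCovariance.Negative.Unbundled
import Summits.QuantumFields.YangMills.Theorems.CurvatureBoostCovariance.Negative.OnAllTestsFalse
import Summits.QuantumFields.YangMills.Theorems.NPointIsotropy.Negative.TieLoadBearing
import Summits.QuantumFields.YangMills.Theorems.NPointIsotropy.Negative.NPointRegularJunk
import Summits.QuantumFields.YangMills.Theorems.NPointIsotropy.Negative.DegreeTwoFree
import Literature.MathematicalPhysics.QuantumFieldTheory.OSReconstructionNoE1
import Literature.MathematicalPhysics.QuantumFieldTheory.OSLorentzInvariance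
import Literature.MathematicalPhysics.AQFT.StandardSubspace
import HarnessLib.Audit

/-!
# Line `anisotropy-costs-a-dimension` — checked skeleton for crux `MirrorModularBoosts.CurvatureBoostCovariance`
(stmt-QuantumFields-9663; crux-plan, round 1; planner-cruxplan-stmt-QuantumFields-9663-anisotropy-costs-a-d-0, 2026-08-16)

Idea (card `Cruxes/CurvatureBoostCovariance/Ideas/anisotropy-costs-a-dimension.md`, triage r1: pass ×3).  After `e₀`-reconstruction
the Euclidean rotation of the `(x⁰,x¹)`-plane is a boost at imaginary rapidity.  TWO-POINT LEVEL (the card's lever): the planar cone +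
the quarter-turn make the rapidity profile of every fibre of the two-point spectral measure a Laurent polynomial in `e^{4χ}`; reflection
positivity on the eight lines `Im χ ∈ (π/4)ℤ` kills an odd top degree; an even top degree `≥ 2` costs EIGHT powers of energy on the fibre,
i.e. UV degree `≥ 10` at the origin — so a curvature two-point function of UV degree `< 10` ("`tr F²` has dimension `< 5`", the only
YM input, in the kernel dress of `PencilRigidity.CurvatureKernelBound`) is RADIAL.  n-POINT LEVEL (the card's S3–S5, this crux's own
content per the triage panel): radial two-point function ⇒ the one-field vectors carry a UNITARY boost group interpolating the real
planar rotations holomorphically (one-field Bisognano–Wichmann, a theorem); THE BET is species reduction — the same interpolating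
unitary group exists on ALL field vectors (species Bisognano–Wichmann: `ℋ₁` reduces the wedge modular group, KMS-uniqueness
`StandardSubspace.subsingleton_modularData_holds` pins it); analytic continuation of unitarity (OS 1973 §4.2 run backwards) then gives
planar-rotation invariance of every `𝔖ₙ` on `⁰𝒮`, the Wilson tie having supplied the `n`-point regularity that defeats the junk families.

Shape (6 stubs; sorries ONLY in `stub_*`; `CurvatureBoostCovariance_of` concludes the crux BY NAME, pure logic):
* S1 `stub_curvatureKernelBound` — YM input, = `PencilRigidity.CurvatureKernelBound` (stmt-QuantumFields-11687) per `G`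
  (`stub_curvatureKernelBound_iff`); USES THE TIE (`curvatureBoostCovariance_false_without_hconv`).
* S2 `stub_twoPointRigidity` — the card's lever at `n = 2`, model-blind, WITH the planar cone (triage T1) and kernel continuity (T2);
  also dischargeable by `PencilRigidity.KernelTransfer ∘ PencilRigidity.ShellRigidity` (`stub_twoPointRigidity_of_pencil`, sorry-free).
* S3 `stub_tieRegularity` — Step 0 (triage G1b), VERBATIM the registered stub of the picked line of `PencilRigidity.NPointIsotropy`
  (`Cruxes/NPointIsotropy/Lines/complex-rotation-bandlimit.lean`); one proof serves both cruxes; USES THE TIE at every order.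
* S4 `stub_oneFieldBoosts` — one-field Bisognano–Wichmann in OS form (model-blind theorem).
* S5 `stub_speciesBoosts` — THE BET: species reduction / lift to all field vectors.
* S6 `stub_rotationsFromBoosts` — OS 1973 §4.2 backwards + a.e. mop-up (model-blind given Step 0).

Vocabulary is LANDED only: `OSPackage Translations Hypercubic EightFrameRP PlanarCone PlanarInvariant W1` of
`Theorems/CurvatureBoostCovariance/Negative/Unbundled.lean` (the crux is definitionally `∀ G …, W1 → EightFrameRP → PlanarCone →
PlanarInvariant`, `crux_iff`), `E4 RadialKernel` of `Theorems/NPointIsotropy/Negative/TieLoadBearing.lean`, the `n`-point regularity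
residual UNFOLDED exactly as registered on stmt-11686, `OSReconstructionNoE1` (`h.Hilbert`, `h.fieldVec`), the tree's
`OneParameterUnitaryGroup` (`V.appReal χ`) and `planeRot (d := 3) 0 θ` (rotation of the `(x⁰,x¹)`-plane).  No local `def`.
-/

noncomputable section

-- Mathlib's `SimplexCategory` instance `Fintype (Fin (x.len + 1))` matches `Fintype (Fin 4)` and makes concrete `Fin 4` instance
-- paths diverge between elaborations (tree-known file-local workaround, as in the landed `Negative/*.lean` files of both cruxes).
attribute [-instance] SimplexCategory.instFintypeToTypeOrderHomFinHAddNatLenOfNat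

namespace Summit.QuantumFields.YangMills.Cruxes.CurvatureBoostCovariance.AnisotropyCostsADimension

open scoped BigOperators SchwartzMap InnerProductSpace
open MeasureTheory Filter Topology Complex
open Literature.MathematicalPhysics.QuantumLattice Literature.MathematicalPhysics.AQFT
  Literature.MathematicalPhysics.QuantumFieldTheory
open Literature.Analysis.UnboundedOperators
open Summit.QuantumFields.YangMills.Theorems.NPointIsotropy.Negative (E4 RadialKernel NPointRegular
  not_NPointIsotropyModelBlind not_nPointRegular_junk radialKernel_invariant_two)
open Summit.QuantumFields.YangMills.Theorems.CurvatureBoostCovariance.Negative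
  (OSPackage Translations Hypercubic EightFrameRP PlanarCone PlanarInvariant Tie Gaps W1 crux_iff
    not_curvatureBoostCovarianceOnAllTests)

/-! ## §1 The six stubs (statements over importable vocabulary only; each wrapped in its own `open … in`) -/

/-- **S1 — the YM input "tr F² has dimension < 5", kernel dress (difficulty: open-problem; SHARED = crux
`PencilRigidity.CurvatureKernelBound`, stmt-QuantumFields-11687, see `stub_curvatureKernelBound_iff`; its picked line is
`Cruxes/CurvatureKernelBound/Lines/sixteen-charts-analytic-kernel.lean`).**  For every compact simple `G`, every `(r, sch, S₁)` with the
curvature package `W1 r sch S₁` (tie + OS package + translations + proper hypercubic invariance + gaps): the two-point function of `S₁`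
on `⁰𝒮` is integration against a REAL kernel `K(x₀ − x₁)`, continuous off `0`, with `|K x| ≤ C (1 + ‖x‖^(η-10))`, `η > 0`.
This is the card's K2 (`CurvatureUVDegree`, UV degree `< 10` in dilated-tensor dress) restated in the kernel currency the triage
panel asked for (T2/T6: continuity off `0` must be supplied, and this is the same open residue — the ORDER of the `tr F²` singularity,
two powers below asymptotic freedom's `|x|⁻⁸ log⁻²`).  The only place besides S3 where the lattice tie enters
(`Disproof.curvatureBoostCovariance_false_without_hconv`: the model-blind core is false, the tie is load-bearing). -/
theorem stub_curvatureKernelBound :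
    open Literature.MathematicalPhysics.QuantumLattice Literature.MathematicalPhysics.AQFT
      Literature.MathematicalPhysics.QuantumFieldTheory
      Summit.QuantumFields.YangMills.Theorems.CurvatureBoostCovariance.Negative
      Summit.QuantumFields.YangMills.Theorems.NPointIsotropy.Negative in
    ∀ (G : Type) [Group G] [TopologicalSpace G] [IsTopologicalGroup G] [CompactSpace G],
      IsCompactSimpleLieGroup G →
      letI : MeasurableSpace G := borel G
      haveI : BorelSpace G := ⟨rfl⟩
      ∀ (r : LatticeRep G) (sch : SpeciesScheme (YMSpecies G)) (S₁ : SchwingerFamily E4), W1 r sch S₁ →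
        ∃ (K : E4 → ℝ) (C η : ℝ), 0 < η ∧ ContinuousOn K {x : E4 | x ≠ 0} ∧
          (∀ x : E4, x ≠ 0 → |K x| ≤ C * (1 + ‖x‖ ^ (η - 10))) ∧
          ∀ F : SchwartzMap (Fin 2 → E4) ℂ, IsOffDiagonal F →
            MeasureTheory.Integrable (fun x : Fin 2 → E4 => (K (x 0 - x 1) : ℂ) * F x) ∧
              S₁ 2 F = ∫ x : Fin 2 → E4, (K (x 0 - x 1) : ℂ) * F x := by
  sorry

/-- **S2 — TWO-POINT RAPIDITY RIGIDITY, the card's lever (model-blind; difficulty L–XL).**  A one-species family on `ℝ⁴` with the OS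
package (E0, E0', E2 along `e₀`, E3, E4), translation and proper hypercubic invariance on `⁰𝒮`, reflection positivity in the EIGHT planar
frames, the planar spectral cone (triage T1: the cone is what makes the rapidity `χ` a coordinate and the contour shifts between the
eight lines legitimate — it is a HYPOTHESIS of this crux, handed over verbatim), whose two-point function on `⁰𝒮` is a real kernel
`K(x₀ − x₁)` continuous off `0` with `|K x| ≤ C (1 + ‖x‖^(η-10))` (UV degree `< 10`): `K` is invariant under EVERY linear isometry off `0`.
Card's proof (i) quarter turn + cone + temperedness ⇒ the planar orbit of the transversely smeared two-point function is an entire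
`π/2`-periodic function of finite exponential type ⇒ a trigonometric polynomial in `e^{4iφ}` (landed: `PencilRigidityNPointIsotropyBandlimit`),
i.e. every fibre profile is Laurent `Σ a_k e^{4kχ}`; (ii) positivity on the eight lines `Im χ = mπ/4` (axis/diagonal pincer,
`coshFour_pincer`) ⇒ the top degree is even; (iii) an even top degree `K* ≥ 2` gives the smeared planar harmonic `≥ c ρ^{-4K*}` against
`O(ρ^{2-γ'})`, `γ' < 10` (triage r1-1 App. B; axis-RP domination `|K(x)| ≤ K(‖x‖_∞ e₀)` localises the singularity at the origin) ⇒
`K* = 0` ⇒ planar invariance; W(B₄) + E3-evenness ⇒ O(4).  Second, independent discharge: `PencilRigidity.KernelTransfer` (support,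
provable now) + `PencilRigidity.ShellRigidity` (stmt-11685, two active leads) imply it by pure logic — `stub_twoPointRigidity_of_pencil`
below — WITHOUT the cone; with the cone this statement is weaker than ShellRigidity (the cone is what ShellRigidity's lines rebuild from
disc sections).  Threshold calibration: planar `8` is sharp (`ShellRigidity.Negative.PlanarThresholdSharp`, `F₈ = cos 8φ/r⁸`), 4D `10`
after transverse smearing; every recorded anisotropic witness (`Ĉ = (1+εe₂(p_μ²)²)/(p²+m²)`, `(Σ∂_μ⁴)²G_m`) sits AT `|x|⁻¹⁰` and fails
the bound. -/
theorem stub_twoPointRigidity :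
    open Literature.MathematicalPhysics.QuantumLattice Literature.MathematicalPhysics.AQFT
      Literature.MathematicalPhysics.QuantumFieldTheory
      Summit.QuantumFields.YangMills.Theorems.CurvatureBoostCovariance.Negative
      Summit.QuantumFields.YangMills.Theorems.NPointIsotropy.Negative in
    ∀ (S₁ : SchwingerFamily E4) (K : E4 → ℝ) (C η : ℝ), OSPackage S₁ → Translations S₁ → Hypercubic S₁ →
      EightFrameRP S₁ → PlanarCone S₁ → 0 < η → ContinuousOn K {x : E4 | x ≠ 0} →
      (∀ x : E4, x ≠ 0 → |K x| ≤ C * (1 + ‖x‖ ^ (η - 10))) →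
      (∀ F : SchwartzMap (Fin 2 → E4) ℂ, IsOffDiagonal F →
        MeasureTheory.Integrable (fun x : Fin 2 → E4 => (K (x 0 - x 1) : ℂ) * F x) ∧
          S₁ 2 F = ∫ x : Fin 2 → E4, (K (x 0 - x 1) : ℂ) * F x) →
      ∀ (R : E4 ≃ₗᵢ[ℝ] E4) (x : E4), x ≠ 0 → K (R x) = K x := by
  sorry

/-- **S3 — Step 0, the stub that USES THE TIE at every order (difficulty XL; a property of the Wilson limit; triage G1b).**  VERBATIM the
registered stub `stub_tieRegularity` of the picked line `complex-rotation-bandlimit` of the sibling crux `PencilRigidity.NPointIsotropy`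
(stmt-QuantumFields-11686): for every compact simple `G` (any Borel structure; the crux instantiates `borel G`), every `(r, sch, S₁)` with
`W1 r sch S₁`, the eight planar frames and the radial kernel (available here after S1 + S2), every `𝔖ₙ|⁰𝒮` is a FUNCTION.  Needed because
the conclusion `PlanarInvariant` reads `𝔖ₙ` on all of `⁰𝒮` while every Hilbert-space argument (S4–S6) only sees configurations with
pairwise distinct frame-times: the landed junk family (`NPointIsotropy.Negative.JunkFamily`, E2 in all eight frames, `𝔖₄ = J ≠ 0` on the
tie locus `𝔈₄`) satisfies every model-blind clause of this crux incl. the cone and violates the conclusion; it violates this residual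
(`not_nPointRegular_junk`).  Certified inhabitants (`c ≡ 0`, `β_k = 0` frequently, vacuum) satisfy it.  Worker verdict on 11686 (wave 1):
not provable from the tree, not cheaply false; the block is exactly `n ≥ 3`.  One landed proof closes it on BOTH cruxes. -/
theorem stub_tieRegularity :
    open Literature.MathematicalPhysics.QuantumLattice Literature.MathematicalPhysics.AQFT
      Literature.MathematicalPhysics.QuantumFieldTheory
      Summit.QuantumFields.YangMills.Theorems.CurvatureBoostCovariance.Negative
      Summit.QuantumFields.YangMills.Theorems.NPointIsotropy.Negative in
    ∀ (G : Type) [Group G] [TopologicalSpace G] [IsTopologicalGroup G] [CompactSpace G]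
      [MeasurableSpace G] [BorelSpace G], IsCompactSimpleLieGroup G →
      ∀ (r : LatticeRep G) (sch : SpeciesScheme (YMSpecies G)) (S₁ : SchwingerFamily E4),
        W1 r sch S₁ → EightFrameRP S₁ → RadialKernel S₁ →
        ∀ n : ℕ, ∃ W : (Fin n → E4) → ℂ, ∀ F : SchwartzMap (Fin n → E4) ℂ, IsOffDiagonal F →
          MeasureTheory.Integrable (fun x : Fin n → E4 => W x * F x) ∧
            S₁ n F = ∫ x : Fin n → E4, W x * F x := by
  sorry

/-- **S4 — ONE-FIELD BISOGNANO–WICHMANN in OS form (model-blind; difficulty L–XL; the card's S3).**  For a one-species family with the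
OS package and translations whose two-point function on `⁰𝒮` is a RADIAL real kernel `K`, continuous off `0`, with the polynomial bound
`|K x| ≤ C (1 + ‖x‖^(η-10))` (all in hand after S1 + S2), on the `e₀`-Osterwalder–Schrader space
(`OSReconstructionNoE1`: `ℋ`, field vectors `Ψ_F` of time-ordered `F`) there is a strongly continuous unitary one-parameter group `V`
("the boosts of the `(x⁰,x¹)`-plane") whose matrix elements against ONE-field vectors interpolate the real planar rotations
holomorphically: for one-point `F`, `G` with `R_θ·G` time-ordered for `θ ∈ (a,b)` there is `Φ` holomorphic on the vertical strip
`a < Re w < b` with `Φ(θ + iχ) = ⟪Ψ_F, V(χ) Ψ_{R_θ·G}⟫` (`R_θ = planeRot 0 θ`).  Proof in hand: radial `K` + RP ⇒ Källén–Lehmann, i.e. the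
two-point spectral measure `μ` (tree: `exists_isJointSpectralMeasure_holds`, Laplace–Fourier representation as in the landed
`PencilRigidityShellRigidityAxisLaplace`) is boost-invariant on the mass hyperboloids; `ℋ₁ ∋ Ψ_g ↦ ĝ_E|supp μ ∈ L²(μ)` is isometric with
dense range (Stone–Weierstrass), so `V₁(χ) := (· ∘ Λ_{-χ})` is a unitary group on `ℋ₁`, extended by `1` on `ℋ₁ᗮ`; and
`(R_θ·g)^_E = ĝ_E ∘ Λ_{iθ}` (imaginary rapidity = Euclidean rotation, cf. `boostC_mul_I_euclideanPoint`), whence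
`Φ(w) = ∫ conj(f̂_E) · ĝ_E ∘ Λ_{iw} dμ`, holomorphic where `R_{Re w}·g` stays at positive times.  Equivalently: the standard subspace of
one-field quadrant vectors has GEOMETRIC modular group (KMS uniqueness, `StandardSubspace.subsingleton_modularData_holds`) — it is
pinning on one-field vectors that FAILS for every anisotropic Laurent profile (triage r1-1 App. A, r1-3 §C) and holds once `K` is radial. -/
theorem stub_oneFieldBoosts :
    open Literature.MathematicalPhysics.QuantumLattice Literature.MathematicalPhysics.AQFT
      Literature.MathematicalPhysics.QuantumFieldTheory Literature.Analysis.UnboundedOperators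
      Summit.QuantumFields.YangMills.Theorems.CurvatureBoostCovariance.Negative
      Summit.QuantumFields.YangMills.Theorems.NPointIsotropy.Negative in
    ∀ (S₁ : SchwingerFamily E4) (K : E4 → ℝ) (C η : ℝ), OSPackage S₁ → Translations S₁ →
      0 < η → ContinuousOn K {x : E4 | x ≠ 0} → (∀ x : E4, x ≠ 0 → |K x| ≤ C * (1 + ‖x‖ ^ (η - 10))) →
      (∀ (R : E4 ≃ₗᵢ[ℝ] E4) (x : E4), x ≠ 0 → K (R x) = K x) →
      (∀ F : SchwartzMap (Fin 2 → E4) ℂ, IsOffDiagonal F →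
        MeasureTheory.Integrable (fun x : Fin 2 → E4 => (K (x 0 - x 1) : ℂ) * F x) ∧
          S₁ 2 F = ∫ x : Fin 2 → E4, (K (x 0 - x 1) : ℂ) * F x) →
      ∀ h : OSReconstructionNoE1 S₁.toLabelled, ∃ V : OneParameterUnitaryGroup h.Hilbert,
        ∀ (F G : SchwartzMap (Fin 1 → E4) ℂ) (hF : IsTimeOrdered F) (a b : ℝ)
          (hG : ∀ θ ∈ Set.Ioo a b, IsTimeOrdered (linActMulti (planeRot (d := 3) 0 θ) G)),
          ∃ Φ : ℂ → ℂ, DifferentiableOn ℂ Φ {w : ℂ | a < w.re ∧ w.re < b} ∧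
            ∀ (θ : ℝ) (hθ : θ ∈ Set.Ioo a b) (χ : ℝ),
              Φ ((θ : ℂ) + (χ : ℂ) * Complex.I) =
                ⟪h.fieldVec 1 (fun _ => ()) F hF,
                  V.appReal χ (h.fieldVec 1 (fun _ => ()) (linActMulti (planeRot (d := 3) 0 θ) G) (hG θ hθ))⟫_ℂ := by
  sorry

/-- **S5 — SPECIES BISOGNANO–WICHMANN, THE BET of the line (difficulty XL; the card's S4 + the lift of triage T4).**  Under every
hypothesis the crux makes available on `S₁` (OS package, translations, proper hypercubic invariance, mass gap, the eight planar frames,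
the planar cone), the radial bounded kernel (S1+S2), the `n`-point regularity residual (S3) and the one-field boosts (S4): the interpolation
property of S4 holds for ALL field vectors — there is ONE unitary group `V` on `ℋ` with `Φ(θ + iχ) = ⟪Ψ_F, V(χ) Ψ_{R_θ·G}⟫` holomorphic
on `a < Re w < b` for every time-ordered `n`-point `F` and every `m`-point `G` rotatable through `(a,b)`.  This is the Euclidean dress of
"the curvature channel is boost covariant": forward, planar invariance + E2 give it (Klein–Landau 1983 / OS 1973 §4.2 / Fröhlich–
Osterwalder–Seiler virtual representations), so it is no stronger than the crux; backward is S6.  Intended mechanism (card + companion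
`one-field-cocycle-pinning`): the wedge standard subspace `K` generated by quadrant field vectors has modular group `Δ_K^{it}`; S4 says
`Δ` is geometric on the one-field space `ℋ₁`; SPECIES REDUCTION = "`ℋ₁` reduces `Δ_K`" (one pinned modular datum on one-field insertions:
the lattice corner-transfer-matrix identity `(P_¼)`, exact at finite `k`, or twisted Gram rigidity on the rapidity cylinder), after
which Tomita–Takesaki (`Δ^{it} M(W) Δ^{-it} = M(W)`, `Ω` separating = wedge locality, the route's layer-2 `AxisWedgeStandardness`) lifts
the geometric action from the generating one-field vectors to all of `ℋ`, and `V(χ) := Δ_K^{∓iχ/2π}`.  Honest status: the regular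
model-blind core of the crux in modular dress — no counterexample known (a killer must be a non-Gaussian, 16-RP, coned, gapped family with
radial `⟨ss⟩`, regular `𝔖ₙ`, and non-geometric wedge modular flow; GFF dressings `s = φ + εB` are SO(4)-scalars mod null,
NPointIsotropy Disproof §11), no proof beyond generalised free fields (GaierYngvason2000); junk-proof through the regularity residual. -/
theorem stub_speciesBoosts :
    open Literature.MathematicalPhysics.QuantumLattice Literature.MathematicalPhysics.AQFT
      Literature.MathematicalPhysics.QuantumFieldTheory Literature.Analysis.UnboundedOperators
      Summit.QuantumFields.YangMills.Theorems.CurvatureBoostCovariance.Negative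
      Summit.QuantumFields.YangMills.Theorems.NPointIsotropy.Negative in
    ∀ (S₁ : SchwingerFamily E4) (K : E4 → ℝ) (C η : ℝ), OSPackage S₁ → Translations S₁ → Hypercubic S₁ →
      (∃ Δ : ℝ, 0 < Δ ∧ S₁.toLabelled.HasMassGap Δ) → EightFrameRP S₁ → PlanarCone S₁ →
      0 < η → ContinuousOn K {x : E4 | x ≠ 0} → (∀ x : E4, x ≠ 0 → |K x| ≤ C * (1 + ‖x‖ ^ (η - 10))) →
      (∀ (R : E4 ≃ₗᵢ[ℝ] E4) (x : E4), x ≠ 0 → K (R x) = K x) →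
      (∀ F : SchwartzMap (Fin 2 → E4) ℂ, IsOffDiagonal F →
        MeasureTheory.Integrable (fun x : Fin 2 → E4 => (K (x 0 - x 1) : ℂ) * F x) ∧
          S₁ 2 F = ∫ x : Fin 2 → E4, (K (x 0 - x 1) : ℂ) * F x) →
      (∀ n : ℕ, ∃ W : (Fin n → E4) → ℂ, ∀ F : SchwartzMap (Fin n → E4) ℂ, IsOffDiagonal F →
        MeasureTheory.Integrable (fun x : Fin n → E4 => W x * F x) ∧
          S₁ n F = ∫ x : Fin n → E4, W x * F x) →
      (∀ h : OSReconstructionNoE1 S₁.toLabelled, ∃ V : OneParameterUnitaryGroup h.Hilbert,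
        ∀ (F G : SchwartzMap (Fin 1 → E4) ℂ) (hF : IsTimeOrdered F) (a b : ℝ)
          (hG : ∀ θ ∈ Set.Ioo a b, IsTimeOrdered (linActMulti (planeRot (d := 3) 0 θ) G)),
          ∃ Φ : ℂ → ℂ, DifferentiableOn ℂ Φ {w : ℂ | a < w.re ∧ w.re < b} ∧
            ∀ (θ : ℝ) (hθ : θ ∈ Set.Ioo a b) (χ : ℝ),
              Φ ((θ : ℂ) + (χ : ℂ) * Complex.I) =
                ⟪h.fieldVec 1 (fun _ => ()) F hF,
                  V.appReal χ (h.fieldVec 1 (fun _ => ()) (linActMulti (planeRot (d := 3) 0 θ) G) (hG θ hθ))⟫_ℂ) →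
      ∀ h : OSReconstructionNoE1 S₁.toLabelled, ∃ V : OneParameterUnitaryGroup h.Hilbert,
        ∀ (n m : ℕ) (F : SchwartzMap (Fin (n + 1) → E4) ℂ) (G : SchwartzMap (Fin (m + 1) → E4) ℂ)
          (hF : IsTimeOrdered F) (a b : ℝ)
          (hG : ∀ θ ∈ Set.Ioo a b, IsTimeOrdered (linActMulti (planeRot (d := 3) 0 θ) G)),
          ∃ Φ : ℂ → ℂ, DifferentiableOn ℂ Φ {w : ℂ | a < w.re ∧ w.re < b} ∧
            ∀ (θ : ℝ) (hθ : θ ∈ Set.Ioo a b) (χ : ℝ),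
              Φ ((θ : ℂ) + (χ : ℂ) * Complex.I) =
                ⟪h.fieldVec (n + 1) (fun _ => ()) F hF,
                  V.appReal χ (h.fieldVec (m + 1) (fun _ => ()) (linActMulti (planeRot (d := 3) 0 θ) G) (hG θ hθ))⟫_ℂ := by
  sorry

/-- **S6 — ROTATIONS FROM BOOSTS: Osterwalder–Schrader 1973 §4.2 run backwards + mop-up (model-blind given Step 0; difficulty L; the
card's S5).**  If a one-species family with the OS package and translations has every `𝔖ₙ|⁰𝒮` a function (S3) and, on its `e₀`-OS space, a
unitary group interpolating the planar rotations on all field vectors (S5), then it is planar-rotation invariant on `⁰𝒮`.  Proof in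
hand: (1) for compactly supported time-ordered `F`, `G` the vector function `w ↦ V(Im w) Ψ_{R_{Re w}·G}` is weakly (hence strongly)
holomorphic, so `g(w) := ⟪V(Im w̄)Ψ_{R_{-Re w}·F}, V(Im w)Ψ_{R_{Re w}·G}⟫` is holomorphic on a strip, constant on the imaginary axis by
UNITARITY, hence constant: `⟪Ψ_{R_{-θ}F}, Ψ_{R_θ G}⟫ = ⟪Ψ_F, Ψ_G⟫`, i.e. `𝔖(R_θ·(ΘF* ⊗ G)) = 𝔖(ΘF* ⊗ G)` for `|θ|` small
(`Θ(R_{-θ}F)* = R_θ·ΘF*`); (2) the `θ` with this property form a subgroup of `ℝ` containing an interval, hence all `θ`, and every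
determinant-one isometry fixing `e₂, e₃` is a `planeRot 0 θ` (4×4 Laplace expansion); (3) with `𝔖ₙ = ∫ Wₙ·` on `⁰𝒮`, the OS-pair
tensors with compactly supported pieces (all splits, time shifts by `Translations`, orderings by E3) determine `Wₙ` a.e. off the null
set of coincident frame-times, so `Wₙ ∘ R_θ = Wₙ` a.e. and `𝔖ₙ(R_θ·F) = 𝔖ₙ(F)` for every off-diagonal `F` (Lebesgue measure is
`R_θ`-invariant; the sibling line's PROVED `stub_mopup` is the same a.e. argument).  False without the regularity residual (the junk
family has a trivial OS space, so its boosts are vacuously unitary: `NPointIsotropy.Negative.not_nPointRegular_junk` is what excludes it). -/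
theorem stub_rotationsFromBoosts :
    open Literature.MathematicalPhysics.QuantumLattice Literature.MathematicalPhysics.AQFT
      Literature.MathematicalPhysics.QuantumFieldTheory Literature.Analysis.UnboundedOperators
      Summit.QuantumFields.YangMills.Theorems.CurvatureBoostCovariance.Negative
      Summit.QuantumFields.YangMills.Theorems.NPointIsotropy.Negative in
    ∀ (S₁ : SchwingerFamily E4), OSPackage S₁ → Translations S₁ →
      (∀ n : ℕ, ∃ W : (Fin n → E4) → ℂ, ∀ F : SchwartzMap (Fin n → E4) ℂ, IsOffDiagonal F →
        MeasureTheory.Integrable (fun x : Fin n → E4 => W x * F x) ∧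
          S₁ n F = ∫ x : Fin n → E4, W x * F x) →
      (∀ h : OSReconstructionNoE1 S₁.toLabelled, ∃ V : OneParameterUnitaryGroup h.Hilbert,
        ∀ (n m : ℕ) (F : SchwartzMap (Fin (n + 1) → E4) ℂ) (G : SchwartzMap (Fin (m + 1) → E4) ℂ)
          (hF : IsTimeOrdered F) (a b : ℝ)
          (hG : ∀ θ ∈ Set.Ioo a b, IsTimeOrdered (linActMulti (planeRot (d := 3) 0 θ) G)),
          ∃ Φ : ℂ → ℂ, DifferentiableOn ℂ Φ {w : ℂ | a < w.re ∧ w.re < b} ∧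
            ∀ (θ : ℝ) (hθ : θ ∈ Set.Ioo a b) (χ : ℝ),
              Φ ((θ : ℂ) + (χ : ℂ) * Complex.I) =
                ⟪h.fieldVec (n + 1) (fun _ => ()) F hF,
                  V.appReal χ (h.fieldVec (m + 1) (fun _ => ()) (linActMulti (planeRot (d := 3) 0 θ) G) (hG θ hθ))⟫_ℂ) →
      PlanarInvariant S₁ := by
  sorry

/-! ## §2 Checks against the tree (sorry-free): sharing, discharge paths, negative knowledge, non-vacuity -/

/-- S1 is literally the shared item `PencilRigidity.CurvatureKernelBound` (stmt-QuantumFields-11687). -/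
theorem stub_curvatureKernelBound_iff :
    (∀ (G : Type) [Group G] [TopologicalSpace G] [IsTopologicalGroup G] [CompactSpace G],
      IsCompactSimpleLieGroup G →
      letI : MeasurableSpace G := borel G
      haveI : BorelSpace G := ⟨rfl⟩
      ∀ (r : LatticeRep G) (sch : SpeciesScheme (YMSpecies G)) (S₁ : SchwingerFamily E4), W1 r sch S₁ →
        ∃ (K : E4 → ℝ) (C η : ℝ), 0 < η ∧ ContinuousOn K {x : E4 | x ≠ 0} ∧
          (∀ x : E4, x ≠ 0 → |K x| ≤ C * (1 + ‖x‖ ^ (η - 10))) ∧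
          ∀ F : 𝓢((Fin 2 → E4), ℂ), IsOffDiagonal F →
            MeasureTheory.Integrable (fun x : Fin 2 → E4 => (K (x 0 - x 1) : ℂ) * F x) ∧
              S₁ 2 F = ∫ x : Fin 2 → E4, (K (x 0 - x 1) : ℂ) * F x) ↔
      Summit.QuantumFields.YangMills.Theses.PencilRigidity.CurvatureKernelBound :=
  Iff.rfl

/-- **Discharge path for S2 through the sibling route** (pure logic, sorry-free): the support item `PencilRigidity.KernelTransfer`
(provable now: E3 + proper hypercubic invariance + the eight frames ⇒ W(B₄)-invariance and axis/diagonal pointwise OS-positivity of the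
kernel) and the crux `PencilRigidity.ShellRigidity` (stmt-QuantumFields-11685) together imply S2 — even without the cone and E0'. -/
theorem stub_twoPointRigidity_of_pencil
    (hKT : Summit.QuantumFields.YangMills.Theses.PencilRigidity.KernelTransfer)
    (hSR : Summit.QuantumFields.YangMills.Theses.PencilRigidity.ShellRigidity) :
    ∀ (S₁ : SchwingerFamily E4) (K : E4 → ℝ) (C η : ℝ), OSPackage S₁ → Translations S₁ → Hypercubic S₁ →
      EightFrameRP S₁ → PlanarCone S₁ → 0 < η → ContinuousOn K {x : E4 | x ≠ 0} →
      (∀ x : E4, x ≠ 0 → |K x| ≤ C * (1 + ‖x‖ ^ (η - 10))) →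
      (∀ F : 𝓢((Fin 2 → E4), ℂ), IsOffDiagonal F →
        MeasureTheory.Integrable (fun x : Fin 2 → E4 => (K (x 0 - x 1) : ℂ) * F x) ∧
          S₁ 2 F = ∫ x : Fin 2 → E4, (K (x 0 - x 1) : ℂ) * F x) →
      ∀ (R : E4 ≃ₗᵢ[ℝ] E4) (x : E4), x ≠ 0 → K (R x) = K x := by
  intro S₁ K C η hOS _htr hhyp h8 _hC hη hKc hKb hKrep
  obtain ⟨hWB4, hax, hdiag⟩ := hKT S₁ K hKc hKrep hOS.2.2.2.2.1 hhyp h8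
  exact hSR K hKc ⟨C, η, hη, hKb⟩ hWB4 hax hdiag

/-- Degree `2` of the conclusion is free once the kernel is radial (landed `NPointIsotropy.Negative.DegreeTwoFree`), for EVERY isometry:
the n-point engine (S4–S6) starts at `n = 3`. -/
example {S₁ : SchwingerFamily E4} (hK : RadialKernel S₁) (R : E4 ≃ₗᵢ[ℝ] E4) (F : 𝓢((Fin 2 → E4), ℂ))
    (hF : IsOffDiagonal F) : S₁ 2 (linActMulti R F) = S₁ 2 F :=
  radialKernel_invariant_two hK R F hF

/-- Negative knowledge honoured (landed, sorry-free): the conclusion must keep `IsOffDiagonal` (Disproof §4) … -/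
example : ¬ Summit.QuantumFields.YangMills.Theorems.CurvatureBoostCovariance.Negative.CurvatureBoostCovarianceOnAllTests :=
  not_curvatureBoostCovarianceOnAllTests

/-- … the regular model-blind n-point core needs the Step-0 residual (junk family, `NPointIsotropy.Negative` files IV/X) … -/
example : ¬ Summit.QuantumFields.YangMills.Theorems.NPointIsotropy.Negative.NPointIsotropyModelBlind :=
  not_NPointIsotropyModelBlind

/-- … which the junk family violates, so S5/S6 are not instances of a landed Negative lemma. -/
example : ¬ NPointRegular Summit.QuantumFields.YangMills.Theorems.NPointIsotropy.Negative.junk :=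
  not_nPointRegular_junk

/-- Non-vacuity of the operator stubs S4–S6: the OS package and translation invariance on `⁰𝒮` ARE the premises of
`OSReconstructionNoE1` for the `Unit`-labelled family, so `h` exists whenever the stubs' hypotheses hold. -/
example (S₁ : SchwingerFamily E4) (hOS : OSPackage S₁) (htr : Translations S₁) : OSReconstructionNoE1 S₁.toLabelled :=
  ⟨hOS.2.2.2.1, fun n _ a F hF => htr n a F hF⟩

/-- The modular engine the bet names is available in the tree: modular data of a standard subspace exist and are unique
(Rieffel–van Daele), so "geometric modular group on one-field vectors" (S4) is a statement about THE modular objects. -/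
example : StandardSubspace.subsingleton_modularData ∧ StandardSubspace.exists_modularData :=
  ⟨StandardSubspace.subsingleton_modularData_holds, StandardSubspace.exists_modularData_holds⟩

/-! ## §3 Composition: the six stubs prove the crux BY NAME (pure logic; the only sorries are the stubs) -/

/-- **The skeleton.**  `W1 →(S1) kernel bound →(S2, with the eight frames and the cone) radial kernel →(S3) n-point regularity;
(S4) one-field boosts →(S5) boosts on all field vectors →(S6) planar invariance on ⁰𝒮`. -/
theorem CurvatureBoostCovariance_of :
    Summit.QuantumFields.YangMills.Theses.MirrorModularBoosts.CurvatureBoostCovariance := by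
  rw [crux_iff]
  intro G _ _ _ _ hG
  letI : MeasurableSpace G := borel G
  haveI : BorelSpace G := ⟨rfl⟩
  intro r sch S₁ hW h8 hC
  -- S1 (tie ⇒ kernel bound), S2 (cone + eight frames ⇒ the kernel is radial)
  obtain ⟨K, C, η, hη, hKc, hKb, hKrep⟩ := stub_curvatureKernelBound G hG r sch S₁ hW
  obtain ⟨hTie, hOS, htr, hhyp, hgaps⟩ := hW
  have hrad : ∀ (R : E4 ≃ₗᵢ[ℝ] E4) (x : E4), x ≠ 0 → K (R x) = K x :=
    stub_twoPointRigidity S₁ K C η hOS htr hhyp h8 hC hη hKc hKb hKrep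
  have hRK : RadialKernel S₁ := ⟨K, hKc, hrad, hKrep⟩
  -- S3 (tie at every order ⇒ every 𝔖ₙ|⁰𝒮 is a function)
  have hreg := stub_tieRegularity G hG r sch S₁ ⟨hTie, hOS, htr, hhyp, hgaps⟩ h8 hRK
  have hgap : ∃ Δ : ℝ, 0 < Δ ∧ S₁.toLabelled.HasMassGap Δ := by
    obtain ⟨Δ, hΔ, hgap, -⟩ := hgaps
    exact ⟨Δ, hΔ, hgap⟩
  -- S4 (one-field boosts), S5 (the bet: boosts on all field vectors), S6 (rotations from boosts)
  have h1 := stub_oneFieldBoosts S₁ K C η hOS htr hη hKc hKb hrad hKrep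
  have hV := stub_speciesBoosts S₁ K C η hOS htr hhyp hgap h8 hC hη hKc hKb hrad hKrep hreg h1
  exact stub_rotationsFromBoosts S₁ hOS htr hreg hV

end Summit.QuantumFields.YangMills.Cruxes.CurvatureBoostCovariance.AnisotropyCostsADimension

end
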